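import Summits.QuantumFields.BalabanUV.T4Continuum.Spine.NE5.TwoRunTorusParam
import Summits.QuantumFields.BalabanUV.T4Continuum.Spine.NE5.TwoRunTorusWalkParametrixTerm

/-!
# Spine/NE5/TwoRunTorusWalkParametrixOutput — the torus chain's OUTPUT `b ↦ E^b(X)` holomorphic with (2.41) uniform
# FROM PARAMETRIX-MODEL TERMS: T17 fed per term by T35 (cell `pub-balaban-gaps`, seat `ne5` gen 10)

WHY.  T26 `TwoRunTorusWalkOutput.differentiableOn_E_torus_of_termWalkData` is T17 `differentiableOn_E_torus_param` fed
per term by T25: per-term walk records at `c⁺` + NON-WALK data (σ-holomorphy of the kernels, NODE A's symmetry ∕ `Re ≻ 0`,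
potentials∕(2.20), χ∕(2.22), fibre bound, numerics) ⟹ `b ↦ E^b(X)(φ)` holomorphic on `ball 0 α` with (2.41) uniform —
row (D4) NODE A's input along the seam (`B = E`) and, with `B = ℂ`, NE5's three per-scale inputs (T26 §2 ∕ T30).  T35
`TwoRunTorusWalkParametrixTerm.hol_and_h226_torus_of_parametrix_param` discharged, for a term of NODE O's PARAMETRIX
model, the σ-holomorphy and symmetry ∕ positivity inputs (the letter `det(1 − R) ≠ 0` read from the step family's
primitive letters + ONE smallness).  THIS FILE is T17 fed per term by T35: `differentiableOn_E_torus_of_parametrixTerms`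
— per `(Z, t, φ)` a parametrix model term `tm Z t φ` with its walk record at `c⁺` for ONE admissible package (g1-p2's
`termWalkData_parametrix` ∕ `acrossSmall_parametrix`; along NE5's pencil T18), the step families' primitive letters with
ONE j-independent package of constants and ONE smallness `K̄_R·m_S·(1+2∕κ_R)^ν < 1`, and the non-walk data WITHOUT
σ-holomorphy ∕ symmetry ∕ positivity ⟹ the same conclusion as T26 §1.  So for NODE O's parametrix family the input of
row (D4) NODE A and of NE5's T16∕T30 is ONE theorem whose hypotheses are: records, primitive letters, potentials∕(2.20),
χ∕(2.22), the Γ-slot fibre bound, rates ∕ numerics (T34), Lemma 3's and (2.39)–(2.41)'s numbers (r10's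
`numerics_nonvacuous`).

HONEST FRAMING.  Pure composition of LANDED shapes (T17; T35; beneath them T33, T25, T21, r10's Lemma-3 torus chain);
every term, record, region, function and number is a HYPOTHESIS; nothing of Bałaban's `C^{(k)}(Z₀,σ)`, `Γ_k(Z₀,σ)`,
`𝐕_k`, `G′_□`, `K′` is constructed or asserted; a MODEL-family feature (g1-plan-1 GEN 22 lens) — whether Bałaban's
operators are such terms with printed constants is NODE O's statement (v)⁺.  NE5 NOT PRINTED ∕ NOT PROVED; leaves 0∕12;
(D4) 0∕1; spine 0∕9.  Rung (B)+1 on a FIXED finite T⁴ — NOT continuum, NOT infinite volume, NOT mass gap, NOT Clay.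
0 sorry, 0 `def`.

Sources: [II] = T. Bałaban, CMP **116** (1988) [Balaban1988RG2Cluster] (1.11) p. 5, p. 13, p. 15, (2.13)–(2.26)
pp. 15–17, Lemma 3 (2.38) p. 20, (2.39)–(2.41) p. 21; [B9] = CMP **99** (1985) [Balaban1985BackgroundPropagators]
(3.87)–(3.90) p. 409, (3.107)–(3.108) p. 416, Thm 3.10 p. 416; C. King, CMP **102** (1986) [King1986] p. 665.
Nothing here is a claim about the Yang–Mills mass gap.
-/

noncomputable section

namespace Summit.QuantumFields.BalabanUV.T4Continuum.Spine.NE5.TwoRunTorusWalkParametrixOutput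

open Matrix Metric Set Finset
open Literature.MathematicalPhysics.QuantumFieldTheory.Balaban1983to89
open Literature.MathematicalPhysics.QuantumFieldTheory.Balaban1983to89.TreeLengthTorus (TPt TDom tsys)
open Literature.MathematicalPhysics.QuantumFieldTheory.Balaban1983to89.TreeLengthTorusGeometry (TTouch)
open Literature.MathematicalPhysics.QuantumFieldTheory.Balaban1983to89.TreeLengthTorusTransfer (tclosure)
open Literature.MathematicalPhysics.QuantumFieldTheory.Balaban1983to89.B13Lemma3TorusData (TBond)
open Literature.MathematicalPhysics.QuantumFieldTheory.Balaban1983to89.B13Lemma3Torus (TwoTorusStep)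
open Literature.MathematicalPhysics.QuantumFieldTheory.Balaban1983to89.B13Lemma3TorusTerms (terms weight Z0)
open Literature.MathematicalPhysics.QuantumFieldTheory.Balaban1983to89.B13Term214 (core214 F214 term214)
open Literature.MathematicalPhysics.QuantumFieldTheory.Balaban1983to89.B13Bound143 (invTau)
open Literature.MathematicalPhysics.QuantumFieldTheory.Balaban1983to89.B5TorusCover (UT)
open Literature.MathematicalPhysics.QuantumFieldTheory.Balaban1983to89.B12TreeDecay (kappa₀ K₀)
open Literature.MathematicalPhysics.QuantumFieldTheory.Balaban1983to89.B13Resummation (locE)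
open Literature.MathematicalPhysics.QuantumFieldTheory.Balaban1983to89.B9Thm34Ext (toB6)
open Literature.MathematicalPhysics.QuantumFieldTheory.Balaban1983to89.B9Thm37GlueTorus (torusGeom tdist1)
open Literature.MathematicalPhysics.QuantumFieldTheory.Balaban1983to89.B11SectG (RowSum)
open Literature.MathematicalPhysics.QuantumFieldTheory.Balaban1983to89.B13TermWalkData (WalkConsts TermKernels TermWalkData)
open Literature.MathematicalPhysics.QuantumFieldTheory.Balaban1983to89.B13TermWalkDataOneTorus (SmallTheta)
open Summit.QuantumFields.BalabanUV.Gaps.D4WalkModelParametrix (ParametrixModelTerm)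
open Summit.QuantumFields.BalabanUV.Gaps.D4WalkBlock (blockNorm)
open Summit.QuantumFields.BalabanUV.Beta.UnitLatticeWalkInversion (Hd)
open Summit.QuantumFields.BalabanUV.T4Continuum.Spine.NE5.TwoRunTorusParam (differentiableOn_E_torus_param)
open Summit.QuantumFields.BalabanUV.T4Continuum.Spine.NE5.TwoRunTorusWalkParametrixTerm
  (hol_and_h226_torus_of_parametrix_param)

variable {L N' : ℕ} [NeZero L] [NeZero N'] {M : ℕ} [NeZero M]
variable {ν : ℕ} {Nf : Fin ν → ℕ} [∀ i, NeZero (Nf i)]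
variable {B : Type*} [NormedAddCommGroup B] [NormedSpace ℂ B]

open Classical in
/-- **`E^b(X)` HOLOMORPHIC WITH (2.41) UNIFORM, FROM PARAMETRIX-MODEL TERMS** (T17 fed per term by T35).  Data as in T26
`differentiableOn_E_torus_of_termWalkData` — the torus model `W`, regions ∕ radii ∕ lists, ONE admissible package `w`
at size `α` with NODE A's `SmallTheta w α θ`, the potentials with (2.20), the common `χ, χᶜ, 𝐃` with (2.22), a Γ-slot
fibre bound, rates and the p. 17 numerics, Lemma 3's and (2.39)–(2.41)'s numbers, the outputs by (2.13) and the space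
restriction — EXCEPT that the per-term records are NODE O's PARAMETRIX model terms `tm Z t φ` with
`TermWalkData ((tm Z t φ).toKernels c⁺) w`, the σ-holomorphy and symmetry ∕ `Re ≻ 0` binders are GONE, and instead the
step families' PRIMITIVE letters (the hypotheses of g1-p2's `termWalkData_parametrix`, one j-independent package of
constants) with (2.61) at rate `μ` and ONE smallness `K̄_R·m_S·(1+2∕κ_R)^ν < 1` at `κ₁ + 1` are taken.  Conclusion =
T26 §1's: for every `X` and `φ ∈ sp2 X`, `b ↦ E^b(X)(φ)` is holomorphic on `ball 0 α` with
`‖E^b(X)(φ)‖ ≤ A₂C₃ε₁e^{−(1−10δ)½Lκd_{k+1}(X)}` — row (D4) NODE A's input (seam, `B = E`) ∕ NE5's per-scale inputs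
(pencil, `B = ℂ`, via T26 §2 `torus_rates_of_output_pencil` and T30) for the parametrix family.
[cite: Balaban1988RG2Cluster, (1.11) p.5, p.13, p.15, (2.13)–(2.26) pp.15–17, (2.38) p.20, (2.41) p.21; Balaban1985BackgroundPropagators, (3.87)–(3.90) p.409, Thm 3.10 p.416; King1986, p.665] -/
theorem differentiableOn_E_torus_of_parametrixTerms (c : B13.Consts) (hL : 8 ≤ c.L) (hLc : c.L = L) (hκ₁ : 1 ≤ c.κ₁)
    (hα₆' : c.α₆ ≠ 0) (W : TwoTorusStep 4 L N')
    -- regions, radii, contour radius, parameter lists (common to the family)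
    (hpos : ∀ Y : TDom 4 (L * N'), 0 < invTau c ((tsys 4 (L * N')).dj Y))
    (hhalf : ∀ Y : TDom 4 (L * N'), invTau c ((tsys 4 (L * N')).dj Y) ≤ 1 / 2)
    {Uτ : TDom 4 (L * N') → Set ℂ} (hUτ : ∀ Y, IsOpen (Uτ Y))
    (hUtau : ∀ Y : TDom 4 (L * N'), closedBall (0 : ℂ) ((invTau c ((tsys 4 (L * N')).dj Y))⁻¹) ⊆ Uτ Y)
    {r : ℝ} (hr : 0 < r) (hr' : r ≤ Real.exp c.κ₁ - 1)
    (hsubτ : ∀ Y, ∀ s ∈ Set.uIcc (0 : ℝ) 1, closedBall (s : ℂ) r ⊆ Uτ Y)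
    (lZ : TDom 4 N' → Finset (TDom 4 (L * N')) × Finset (TBond 4 M (L * N')) → List (TPt 4 N'))
    (hlZ : ∀ Z t, (lZ Z t).Nodup ∧ (lZ Z t).toFinset = Z.1 \ tclosure L N' (Z0 M t))
    (lD : Finset (TDom 4 (L * N')) × Finset (TBond 4 M (L * N')) → List (TDom 4 (L * N')))
    (hlD : ∀ t, (lD t).Nodup ∧ (lD t).toFinset = t.1)
    -- PER-TERM WALK RECORDS AT `c⁺` OVER THE PARAMETER SPACE, ONE ADMISSIBLE PACKAGE
    (tm : (Z : TDom 4 N') → Finset (TDom 4 (L * N')) × Finset (TBond 4 M (L * N')) → W.Φ →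
      ParametrixModelTerm 4 N' ν Nf B)
    [∀ Z t φ, Fintype ((tm Z t φ).toKernels ({ c with κ₁ := c.κ₁ + 1 } : B13.Consts)).C₀]
    [∀ Z t φ, DecidableEq ((tm Z t φ).toKernels ({ c with κ₁ := c.κ₁ + 1 } : B13.Consts)).C₀]
    {w : WalkConsts} {α Rσ₀ : ℝ} (hw : w.Admissible α Rσ₀) (hα : 0 < α)
    (h𝒦 : ∀ Z, ∀ t ∈ terms L M Z, ∀ φ, φ ∈ W.sp2 Z → TermWalkData ((tm Z t φ).toKernels ({ c with κ₁ := c.κ₁ + 1 } :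
        B13.Consts)) w)
    -- PER-TERM PRIMITIVE LETTERS OF THE STEP FAMILIES (the hypotheses of g1-p2's `termWalkData_parametrix`), ONE
    -- j-independent package of constants, + ONE smallness → the letter `det(1 − R) ≠ 0` per term (T33 §5)
    {Rb CL lamK rD : ℝ} {mJ nD nC : ℕ} {ρR kapR μ cμ : ℝ}
    (hanchor : ∀ Z t φ b, (tm Z t φ).L.anchor b ∈ (tm Z t φ).L.dom b)
    (hdiam : ∀ Z t φ b, ∀ z ∈ (tm Z t φ).L.dom b, ∀ z' ∈ (tm Z t φ).L.dom b, tdist1 Nf z z' ≤ rD)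
    (hJ : ∀ Z t φ b, ((tm Z t φ).L.J b).card ≤ mJ)
    (hX : ∀ Z t φ b, ((tm Z t φ).L.J b).Nonempty → ((tm Z t φ).L.dom b ∩ (tm Z t φ).X).Nonempty)
    (hmult : ∀ Z t φ, ∀ z : UT Nf, (Finset.univ.filter fun b => (tm Z t φ).L.anchor b = z).card ≤ nD)
    (hsupp : ∀ Z t φ b y, y ∉ (tm Z t φ).Es b → (tm Z t φ).h b y = 0) (hhabs : ∀ Z t φ b y, |(tm Z t φ).h b y| ≤ 1)
    (hE : ∀ Z t φ b y, y ∈ (tm Z t φ).Es b → (tm Z t φ).cubn y ∈ (tm Z t φ).L.dom b)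
    (hLan : ∀ Z t φ b i j, DifferentiableOn ℂ (fun u => (tm Z t φ).L.op b u i j) (ball (0 : B) Rb))
    (hLbd : ∀ Z t φ b, ∀ u ∈ ball (0 : B) Rb, ∀ y y',
      blockNorm (tm Z t φ).cubn (tm Z t φ).cubn ((tm Z t φ).L.op b u) y y' ≤ CL) (hCL : 0 ≤ CL)
    (hKan : ∀ Z t φ i j, DifferentiableOn ℂ (fun u => (tm Z t φ).K' u i j) (ball (0 : B) Rb))
    (hKbd : ∀ Z t φ b, ∀ u ∈ ball (0 : B) Rb, ∀ y y', blockNorm (tm Z t φ).cubn (tm Z t φ).cubn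
      (Hd ((tm Z t φ).h) b * (tm Z t φ).K' u - (tm Z t φ).K' u * Hd ((tm Z t φ).h) b) y y' ≤ lamK) (hlamK : 0 ≤ lamK)
    (hKsupp : ∀ Z t φ b u y y', blockNorm (tm Z t φ).cubn (tm Z t φ).cubn
      (Hd ((tm Z t φ).h) b * (tm Z t φ).K' u - (tm Z t φ).K' u * Hd ((tm Z t φ).h) b) y y' ≠ 0 →
      y ∈ (tm Z t φ).L.dom b ∧ y' ∈ (tm Z t φ).L.dom b)
    (hcard : ∀ Z t φ b, ((tm Z t φ).L.dom b).card ≤ nC)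
    (hρR : 0 ≤ ρR) (hkapR : 0 < kapR) (hμ : 0 ≤ μ) (hwin : kapR + μ ≤ ρR)
    (hrow : RowSum (toB6 (torusGeom Nf 0 0 0) 0 True) μ cμ) (hcμ : 0 ≤ cμ)
    {mS : ℕ} (hfibS : ∀ Z t φ, ∀ x : UT Nf, (Finset.univ.filter fun j => (tm Z t φ).cubn j = x).card ≤ mS)
    (hsmallR : (((nC : ℝ) * lamK * CL) * Real.exp ((c.κ₁ + 1) * mJ) * Real.exp (2 * ρR * rD) * Real.exp (μ * rD)
      * ((nD : ℝ) * cμ)) * (mS * (1 + 2 / kapR) ^ ν) < 1) (hαRb : α ≤ Rb)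
    (Γ : (Z : TDom 4 N') → (t : Finset (TDom 4 (L * N')) × Finset (TBond 4 M (L * N'))) → (φ : W.Φ) → B →
      (TPt 4 N' → ℂ) → (((tm Z t φ).toKernels ({ c with κ₁ := c.κ₁ + 1 } : B13.Consts)).Λ ⊕ ((tm Z t φ).toKernels ({
        c with κ₁ := c.κ₁ + 1 } : B13.Consts)).C₀ → ℝ) → (((tm Z t φ).toKernels ({ c with κ₁ := c.κ₁ + 1 } :
        B13.Consts)).Λ → ℂ))
    (hlin : ∀ Z, ∀ t ∈ terms L M Z, ∀ φ, φ ∈ W.sp2 Z → ∀ b ∈ ball (0 : B) α, ∀ σ : TPt 4 N' → ℂ,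
      (∀ j, σ j ∈ ball (0 : ℂ) (Real.exp (c.κ₁ + 1))) →
        ∀ X : ((tm Z t φ).toKernels ({ c with κ₁ := c.κ₁ + 1 } : B13.Consts)).Λ ⊕ ((tm Z t φ).toKernels ({ c with κ₁
        := c.κ₁ + 1 } : B13.Consts)).C₀ → ℝ, Γ Z t φ b σ X = ((tm Z t φ).toKernels ({ c with κ₁ := c.κ₁ + 1 } :
        B13.Consts)).G2 σ b *ᵥ fun j => (X j : ℂ))
    (χY₀ χcP : (Z : TDom 4 N') → (t : Finset (TDom 4 (L * N')) × Finset (TBond 4 M (L * N'))) → (φ : W.Φ) →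
      (((tm Z t φ).toKernels ({ c with κ₁ := c.κ₁ + 1 } : B13.Consts)).Λ → ℝ) → ℝ)
    (hχ0 : ∀ Z t φ Bf, 0 ≤ χY₀ Z t φ Bf) (hχc0 : ∀ Z t φ Bf, 0 ≤ χcP Z t φ Bf)
    (Dfam : TDom 4 N' → Finset (TDom 4 (L * N')) × Finset (TBond 4 M (L * N')) → Finset (TDom 4 (L * N')))
    (Vk : (Z : TDom 4 N') → (t : Finset (TDom 4 (L * N')) × Finset (TBond 4 M (L * N'))) → (φ : W.Φ) → B →
      TDom 4 (L * N') → (((tm Z t φ).toKernels ({ c with κ₁ := c.κ₁ + 1 } : B13.Consts)).Λ → ℝ) → ℂ)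
    -- non-walk data: potentials, measurability (σ-holomorphy and NODE A's symmetry ∕ `Re ≻ 0` are FREE here)
    (hVholb : ∀ Z, ∀ t ∈ terms L M Z, ∀ φ, φ ∈ W.sp2 Z → ∀ Y Bf,
      DifferentiableOn ℂ (fun b => Vk Z t φ b Y Bf) (ball (0 : B) α))
    (hχm : ∀ Z t φ, Measurable (χY₀ Z t φ)) (hχcm : ∀ Z t φ, Measurable (χcP Z t φ))
    (hVm : ∀ Z, ∀ t ∈ terms L M Z, ∀ φ, φ ∈ W.sp2 Z → ∀ b ∈ ball (0 : B) α, ∀ Y, Measurable (Vk Z t φ b Y))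
    -- (2.22) and (2.20), uniform along the parameter
    {γ₂ rP a₂₀ w₂₀ : ℝ}
    (qP : (Z : TDom 4 N') → (t : Finset (TDom 4 (L * N')) × Finset (TBond 4 M (L * N'))) → (φ : W.Φ) →
      (((tm Z t φ).toKernels ({ c with κ₁ := c.κ₁ + 1 } : B13.Consts)).Λ → ℝ) → ℝ)
    (h222 : ∀ Z t φ Bf, χY₀ Z t φ Bf * χcP Z t φ Bf ≤
      Real.exp (-(γ₂ / 2 * rP ^ 2 * (t.2.card : ℕ)) + γ₂ / 2 * qP Z t φ Bf))
    (hγ₂ : 0 ≤ γ₂) (hqP : ∀ Z t φ Bf, qP Z t φ Bf ≤ Bf ⬝ᵥ Bf) (ha0 : 0 ≤ a₂₀)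
    (h220U : ∀ Z, ∀ t ∈ terms L M Z, ∀ φ, φ ∈ W.sp2 Z → ∀ b ∈ ball (0 : B) α, ∀ τ : TDom 4 (L * N') → ℂ,
      (∀ Y, τ Y ∈ Uτ Y) → ∀ Bf, ∑ Y ∈ Dfam Z t, ‖τ Y‖ * ‖Vk Z t φ b Y Bf‖ ≤ a₂₀ / 2 * (Bf ⬝ᵥ Bf) + w₂₀)
    -- a common fibre bound
    {m : ℕ} (hm : ∀ Z t φ, ((tm Z t φ).toKernels ({ c with κ₁ := c.κ₁ + 1 } : B13.Consts)).m ≤ m)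
    (hfibN : ∀ Z t φ, ∀ x : UT Nf, (Finset.univ.filter fun j => ((tm Z t φ).toKernels ({ c with κ₁ := c.κ₁ + 1 } :
        B13.Consts)).locN j = x).card ≤ m)
    -- one package of rates and p. 17 numerics in the record's letters
    {κa κb kap' kap'' θ : ℝ} (hκa : κa < w.kap) (hκb : κb < κa) (h2 : kap' < κb) (h1 : kap'' < kap')
    (hkap'' : 0 < kap'')
    (hsm : SmallTheta w α θ)
    (hθR1le : ∀ Z t φ, ((m : ℝ) * (1 + 2 / (κb - kap')) ^ ν) * (m * (1 + 2 / (kap' - kap'')) ^ ν)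
      * ((2 * w.KbarΓ * Real.exp (-(w.ε * w.Rσ)) + 2 * w.KbarΓ * α / w.R) * w.KbarC * w.KbarΓ
        + w.KbarΓ * (w.KbarC * (2 * w.KbarE * Real.exp (-(w.ε * w.Rσ)) + 2 * w.KbarE * α / w.R)
            * (((tm Z t φ).toKernels ({ c with κ₁ := c.κ₁ + 1 } : B13.Consts)).m * (1 + 2 / (w.kap - κa)) ^ ν) *
        w.KbarC * (((tm Z t φ).toKernels ({ c with κ₁ := c.κ₁ + 1 } : B13.Consts)).m * (1 + 2 / (κa - κb)) ^ ν))
            * w.KbarΓ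
        + w.KbarΓ * w.KbarC * (2 * w.KbarΓ * Real.exp (-(w.ε * w.Rσ)) + 2 * w.KbarΓ * α / w.R)) ≤ θ)
    (hsmallKθ : w.KbarC * (m * (1 + 2 / κb) ^ ν) * (θ * (m * (1 + 2 / kap'') ^ ν)) < 1)
    {cE g : ℝ} (hc0 : 0 ≤ cE) (hc : ∀ Z t φ k, ((tm Z t φ).toKernels ({ c with κ₁ := c.κ₁ + 1 } :
        B13.Consts)).hC.1.eigenvalues k ≤ cE)
    (hαc : (2 * (θ * (m * (1 + 2 / kap'') ^ ν)) + (γ₂ + a₂₀)) * cE ≤ 1 / 2) (hg : 0 ≤ g)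
    (hΓq : ∀ Z, ∀ t ∈ terms L M Z, ∀ φ, φ ∈ W.sp2 Z → ∀ X : ((tm Z t φ).toKernels ({ c with κ₁ := c.κ₁ + 1 } :
        B13.Consts)).Λ ⊕ ((tm Z t φ).toKernels ({ c with κ₁ := c.κ₁ + 1 } : B13.Consts)).C₀ → ℝ,
      (((tm Z t φ).toKernels ({ c with κ₁ := c.κ₁ + 1 } : B13.Consts)).Γ₀ *ᵥ X) ⬝ᵥ (((tm Z t φ).toKernels ({ c with
        κ₁ := c.κ₁ + 1 } : B13.Consts)).C *ᵥ (((tm Z t φ).toKernels ({ c with κ₁ := c.κ₁ + 1 } : B13.Consts)).Γ₀ *ᵥ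
        X)) ≤ g * (X ⬝ᵥ X))
    (hsmall : (2 * (θ * (m * (1 + 2 / kap'') ^ ν)) + (γ₂ + a₂₀)) * (1 + 2 * cE * g) ≤ 1 / 2)
    {a a₅ : ℝ} (hPa : a ≤ γ₂ * rP ^ 2)
    (hvol : ∀ Z, ∀ t ∈ terms L M Z, ∀ φ, φ ∈ W.sp2 Z →
      2 * (w.KbarC * (m * (1 + 2 / κb) ^ ν) * (θ * (m * (1 + 2 / kap'') ^ ν))
              * (1 + (1 - w.KbarC * (m * (1 + 2 / κb) ^ ν) * (θ * (m * (1 + 2 / kap'') ^ ν)))⁻¹) / 2)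
          * (Fintype.card ((tm Z t φ).toKernels ({ c with κ₁ := c.κ₁ + 1 } : B13.Consts)).Λ : ℝ)
        + w₂₀ + (2 * (θ * (m * (1 + 2 / kap'') ^ ν)) + (γ₂ + a₂₀)) * cE * (Fintype.card ((tm Z t φ).toKernels ({ c
        with κ₁ := c.κ₁ + 1 } : B13.Consts)).Λ : ℝ)
        + (2 * (θ * (m * (1 + 2 / kap'') ^ ν)) + (γ₂ + a₂₀)) * (1 + 2 * cE * g)
          * (Fintype.card (((tm Z t φ).toKernels ({ c with κ₁ := c.κ₁ + 1 } : B13.Consts)).Λ ⊕ ((tm Z t φ).toKernels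
        ({ c with κ₁ := c.κ₁ + 1 } : B13.Consts)).C₀) : ℝ)
        ≤ a₅ * ((Z.1).card : ℝ))
    -- Lemma 3's and (2.39)–(2.41)'s numbers, verbatim as in T17
    {a₂ a₂' Aabs : ℝ}
    (hα₆ : 0 < c.α₆) (hε₀ : 0 ≤ c.eps2) (hδ : 0 ≤ c.δ) (hδ7 : 0 ≤ 1 - 7 * c.δ) (hκ : 0 ≤ c.κ) (ha : 0 ≤ a)
    (hR15 : c.R15) (hR16 : 18 * ((1 - 4 * c.δ) * c.κ) ≤ a / 20) (hR16' : 4 * c.κ ≤ a / 20)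
    (hR17 : Real.exp (-(a / 20)) ≤ c.eps2) (h231 : 2 * (4 : ℝ) * (M : ℝ) ^ 4 * Real.exp (-(a / 10)) ≤ a / 20)
    (ha₂ : 0 ≤ a₂) (hκ229 : kappa₀ 64 8 + a₂ ≤ c.δ * c.κ)
    (hsm229 : c.α₆ * Real.exp a₂ * K₀ 64 8 * 64 ≤ a₂)
    (habsk : Real.exp (-(a / 20)) * 64 ≤ c.δ * c.κ)
    (h18half : B13Step237.R18half c (K₀ 64 8 * Real.exp (Real.exp (-(a / 20)) * 64)))
    (h18 : B13Step237.R18sharp c (K₀ 64 8 * Real.exp (Real.exp (-(a / 20)) * 64)) ((c.L : ℝ) / 2))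
    (ha₂' : 0 ≤ a₂') (hκ229' : kappa₀ 64 8 + a₂' ≤ c.δ * ((c.L : ℝ) / 2) * c.κ)
    (hsm229' : c.α₆ * Real.exp a₂' * K₀ 64 8 * 64 ≤ a₂')
    (hR20 : 18 * ((1 - 7 * c.δ) * ((c.L : ℝ) / 2) * c.κ) ≤ (c.κ₁ - 1) / 2)
    (ha₅ : 0 ≤ a₅) (habs : a₅ + Real.exp (-((c.κ₁ - 1) / 2)) ≤ Aabs)
    (hAc : Aabs * 64 ≤ c.δ * ((c.L : ℝ) / 2) * c.κ)
    (hC3 : B13Step237.bracketF c (K₀ 64 8 * Real.exp (Real.exp (-(a / 20)) * 64)) / c.α₆ *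
      Real.exp (Aabs * 64) ≤ c.C3act * c.ε₁)
    -- the members' activities are the sums of the (2.14)-terms read from the records; (2.13); space restriction
    {H : B → TDom 4 N' → W.Φ → ℂ}
    (hH : ∀ b ∈ ball (0 : B) α, ∀ (Z : TDom 4 N') (φ : W.Φ), φ ∈ W.sp2 Z → H b Z φ = ∑ t ∈ terms L M Z,
      term214 r (lZ Z t) (lD t) (core214 (fun σ => ((tm Z t φ).toKernels ({ c with κ₁ := c.κ₁ + 1 } : B13.Consts)).A2
        σ b) (Γ Z t φ b)
        (F214 t.2.card (χY₀ Z t φ) (χcP Z t φ) (Dfam Z t) (Vk Z t φ b))) 0 0)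
    (hsp : ∀ X Z : TDom 4 N', ∀ φ, Z.1 ⊆ X.1 → φ ∈ W.sp2 X → φ ∈ W.sp2 Z)
    {E : B → TDom 4 N' → W.Φ → ℂ}
    (h213 : ∀ b ∈ ball (0 : B) α, ∀ (X : TDom 4 N') (φ : W.Φ), φ ∈ W.sp2 X →
      E b X φ = locE (TTouch (d := 4) (N := N')) (fun Z : TDom 4 N' => Z.1) (fun Z => H b Z φ) X.1)
    (hAct : 0 ≤ c.C3act * c.ε₁) (hr₁ : 0 ≤ (1 - 10 * c.δ) * ((c.L : ℝ) / 2) * c.κ)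
    (hlarge : (1 - 10 * c.δ) * ((c.L : ℝ) / 2) * c.κ + 2 * (64 * Real.log 162) + 2 ≤
      (1 - 8 * c.δ) * ((c.L : ℝ) / 2) * c.κ)
    (hsmall41 : c.C3act * c.ε₁ * Real.exp (5 * ((1 - 10 * c.δ) * ((c.L : ℝ) / 2) * c.κ) + 1) * K₀ 64 8 * 9 * 64 ≤ 1)
    (hA₂ : Real.exp 1 * 9 * 64 * K₀ 64 8 ^ 2 ≤ c.A₂) :
    ∀ (X : TDom 4 N') (φ : W.Φ), φ ∈ W.sp2 X →
      DifferentiableOn ℂ (fun b => E b X φ) (ball (0 : B) α) ∧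
        ∀ b ∈ ball (0 : B) α, ‖E b X φ‖ ≤
          c.A₂ * c.C3act * c.ε₁ * Real.exp (-((1 - 10 * c.δ) * ((c.L : ℝ) / 2) * c.κ * (tsys 4 N').dj X)) := by
  -- the (2.14)-term families of the parametrix records
  let P : (Z : TDom 4 N') → Finset (TDom 4 (L * N')) × Finset (TBond 4 M (L * N')) → W.Φ → B → ℂ :=
    fun Z t φ b => term214 r (lZ Z t) (lD t) (core214 (fun σ => ((tm Z t φ).toKernels ({ c with κ₁ := c.κ₁ + 1 } : B13.Consts)).A2 σ b) (Γ Z t φ b)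
      (F214 t.2.card (χY₀ Z t φ) (χcP Z t φ) (Dfam Z t) (Vk Z t φ b))) 0 0
  -- T35 per term and configuration
  have key : ∀ (Z : TDom 4 N') (φ : W.Φ), φ ∈ W.sp2 Z → ∀ t ∈ terms L M Z,
      DifferentiableOn ℂ (P Z t φ) (ball (0 : B) α) ∧
        ∀ b ∈ ball (0 : B) α, ‖P Z t φ b‖ ≤ weight L M c Z a t * Real.exp (a₅ * ((Z.1).card : ℝ)) := by
    intro Z φ hφ t ht
    exact hol_and_h226_torus_of_parametrix_param c hκ₁ hα₆' Z t hpos hhalf hUτ hUtau hr hr' hsubτ (lZ Z t)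
      (hlZ Z t) (lD t) (hlD t) (tm Z t φ) hw hα (h𝒦 Z t ht φ hφ) (hanchor Z t φ) (hdiam Z t φ) (hJ Z t φ)
      (hX Z t φ) (hmult Z t φ) (hsupp Z t φ) (hhabs Z t φ) (hE Z t φ) (hLan Z t φ) (hLbd Z t φ) hCL (hKan Z t φ)
      (hKbd Z t φ) hlamK (hKsupp Z t φ) (hcard Z t φ) hρR hkapR hμ hwin hrow hcμ (hfibS Z t φ) hsmallR hαRb
      (Γ Z t φ) (hlin Z t ht φ hφ) (χY₀ Z t φ) (χcP Z t φ) (hχ0 Z t φ) (hχc0 Z t φ) (Dfam Z t) (Vk Z t φ)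
      (hVholb Z t ht φ hφ) (hχm Z t φ) (hχcm Z t φ) (hVm Z t ht φ hφ) (qP Z t φ) (h222 Z t φ) hγ₂ (hqP Z t φ)
      ha0 (h220U Z t ht φ hφ) (hm Z t φ) (hfibN Z t φ) hκa hκb h2 h1 hkap'' hsm (hθR1le Z t φ) hsmallKθ hc0
      (hc Z t φ) hαc hg (hΓq Z t ht φ hφ) hsmall hPa (hvol Z t ht φ hφ)
  exact differentiableOn_E_torus_param c hL hLc W P isOpen_ball (fun Z φ hφ t ht => (key Z φ hφ t ht).1)
    (fun b hb Z φ hφ t ht => (key Z φ hφ t ht).2 b hb) hα₆ hε₀ hδ hδ7 hκ ha hR15 hR16 hR16' hR17 h231 ha₂ hκ229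
    hsm229 habsk h18half h18 ha₂' hκ229' hsm229' hR20 ha₅ habs hAc hC3 hH hsp h213 hAct hr₁ hlarge hsmall41 hA₂

end Summit.QuantumFields.BalabanUV.T4Continuum.Spine.NE5.TwoRunTorusWalkParametrixOutput

end
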